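import Summits.AtomisticToContinuum.BoseEinsteinCondensation.Theses.BECCutLineWeakDisorder
import Summits.AtomisticToContinuum.BoseEinsteinCondensation.Theses.BECClassicalWindow
import Summits.AtomisticToContinuum.BoseEinsteinCondensation.Theses.BECCellInformation
import Literature.MathematicalPhysics.QuantumManyBody.GroundState
import Summits.AtomisticToContinuum.BoseEinsteinCondensation.Theorems.BECCutLineWeakDisorderGroundStateRigidityStubCompactness
import Summits.AtomisticToContinuum.BoseEinsteinCondensation.Theorems.BECCutLineWeakDisorderGroundStateRigidityStubRigidityOfUnique
import Summits.AtomisticToContinuum.BoseEinsteinCondensation.Theorems.BECCutLineWeakDisorderGroundStateRigidityStubFiniteEnergyLowDensity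
import Summits.AtomisticToContinuum.BoseEinsteinCondensation.Theorems.BECCutLineWeakDisorderGroundStateRigidityStubExistsNonnegGroundState
import Summits.AtomisticToContinuum.BoseEinsteinCondensation.Theorems.BECCutLineWeakDisorderGroundStateRigidityEssBounded
import Summits.AtomisticToContinuum.BoseEinsteinCondensation.Theorems.BECCutLineWeakDisorderGroundStateRigidityUniqueEssBounded
import Summits.AtomisticToContinuum.BoseEinsteinCondensation.Theorems.BECCutLineWeakDisorderGroundStateRigidityLocBdd
import Summits.AtomisticToContinuum.BoseEinsteinCondensation.Theorems.BECCutLineWeakDisorderGroundStateRigidityStubLincombGroundState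
import Summits.AtomisticToContinuum.BoseEinsteinCondensation.Theorems.BECCutLineWeakDisorderGroundStateRigidityStubVanishOffFree
import Summits.AtomisticToContinuum.BoseEinsteinCondensation.Theorems.BECCutLineWeakDisorderGroundStateRigidityStubUniqueOfPosOn
import Summits.AtomisticToContinuum.BoseEinsteinCondensation.Theorems.BECCutLineWeakDisorderGroundStateRigidityStubLocalTubeCore
import Summits.AtomisticToContinuum.BoseEinsteinCondensation.Theorems.BECCutLineWeakDisorderGroundStateRigidityStubPolygonalChain
import Summits.AtomisticToContinuum.BoseEinsteinCondensation.Theorems.BECCutLineWeakDisorderGroundStateRigidityStubChainedTube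
import Summits.AtomisticToContinuum.BoseEinsteinCondensation.Theorems.BECCutLineWeakDisorderGroundStateRigidityStubPosOfConnected
import Summits.AtomisticToContinuum.BoseEinsteinCondensation.Theorems.BECCutLineWeakDisorderGroundStateRigidityHardCoreOfConnected
import Summits.AtomisticToContinuum.BoseEinsteinCondensation.Theorems.GroundStateRigidity.Negative.LoadBearingHypotheses
import HarnessLib.Audit

/-!
# Line `persistent-confinement` — ALTERNATIVE skeleton for crux `GroundStateRigidity`
(item stmt-AtomisticToContinuum-9072, shared by 8 routes; strategist seat
planner-cstrat-stmt-AtomisticToContinuum-9072-s1-0, 2026-08-17; registered with `--alt`, it does NOT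
touch the live lead's line `Sketch` (skeleton v8, sha d694a874f8f0) or its stubs.)

Crux (fixed, by name): `GroundStateRigidity` — for every repulsive finite-range `v` there is `ρ₀ > 0`
such that for `0 < ρ < ρ₀`, all large `N` and every `η > 0` some `δ > 0` makes any two `δ`-near-minimisers
of the Dirichlet energy in the box of side `(N/ρ)^{1/3}` `η`-close in `L²` up to a constant phase.

## What this line changes relative to `Sketch` (and why it dodges the STUCK goal)

Line `Sketch` is proved (all glue landed) down to two research kernels: Stub 21 `stub_cubeConnected`
(the dilute hard-sphere free region `F_b(N,L) = {X ∈ Λ_L^N : |xᵢ − xⱼ| > b}` is PATH-CONNECTED at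
`N b³ ≤ c₀ L³` — Baryshnikov–Bubenik–Kahle's open question, IMRN 2014 §6, flagged "not safely true" by the
lead's own structure theory, NOTES-c4-KERNEL §2: sparse container-jammed "vault foams" would refute it
while leaving the crux intact) and Stub 22 (the zoo). The stuck goal is CONNECTIVITY OF ALL OF `F_b`.

The crux does not need connectivity: it needs that the ENERGY-MINIMISING part of `F_b` is one connected,
`S_N`-invariant piece. This line prices components out by the kinetic energy of ONE persistently
confined label, so its geometric kernel only has to control components that carry NO persistent
confinement at all:

* `stub_unconfinedUnique` (OPEN KERNEL, pure discrete geometry, rank-2 hardest): at `K₁ b ≤ D`,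
  `N D³ ≤ c₁ L³`, any two configurations of `F_b(N,L)` whose components carry no label that is
  PERSISTENTLY `D`-confined (to one wall face, or to one other label, throughout the component) are
  joined in `F_b(N,L)`. Strictly WEAKER than `CubeConnected` (which is the case "every two
  configurations are joined"), weaker than the lead's contingency reshape (TT) "every trapped component
  has a label-pinned backbone with confinement `≤ K b`" (here the confinement scale is the large
  `D ≍ ρ^{-1/3} ≫ b`, relative or wall confinement both count, and only ONE label is asked for), and TRUE
  on every trap mechanism on the table (jammed / near-jammed wall-braced backbones, vault foams, notched
  rings, Böröczky–Kahle bridges: all have wall footings and contacts that persist at scale `O(b) ≪ D`).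
  Its only failure mode is a pair of distinct "treadmill" components (every label sheds every frame
  somewhere, yet the component never dissolves) — the object the disprover could not construct
  (Disproof.lean verdict: "a refutation would need a NEW kind of component (loose yet caged)").
* `stub_frameConfinementFloor` (M): a `C¹` Dirichlet `(N+1)`-body function (NO symmetry asked) one of whose
  labels is confined — to the slab of width `D` at a wall face, or to the closed `D`-ball around another
  label — on its support has energy `≥ (E₀(N, L) + c_F/D²)·mass`: one-dimensional Poincaré in the confined
  coordinate of the confined label, fibrewise; the other `N` labels' slice is an admissible `N`-body
  function after the diamagnetic `√`-SYMMETRISATION `Φ = (N!⁻¹ Σ_π |ψ∘π|²)^{1/2}` (convexity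
  `|∇(Σ|f_π|²)^{1/2}|² ≤ Σ|∇f_π|²`, tree `sqrtReg` smoothing), which is how this line gets "Bose = Boltzmann"
  for free — no component-wise Perron–Frobenius in the Boltzmann frame is needed (the dossier's (Bose=abs)).
* `stub_insertionBose` (M–L): the BOSE-frame insertion window `E₀(N+1, L) ≤ E₀(N, L) + C/ℓ²` whenever
  `C (N+1) ℓ³ ≤ L³` and `ℓ ≥ R₀` (range): among `≥ 100(N+1)` cells of side `O(ℓ)` some FIXED cell `c₀` is,
  under `|Φ|²` of a near-minimiser `Φ`, empty with probability `≥ 1/2` and has expected boundary-layer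
  occupation `O(1)` (averaging over cells — deterministic pigeonhole at every configuration); IMS with the
  symmetric `C¹` pair `cos θ(X), sin θ(X)` localises `Φ` to "no particle near `c₀`" at cost `O(1/ℓ²)`; the
  new particle goes into the Dirichlet ground state of `c₀`, and the Bose symmetrisation of the product
  has `N+1` terms with PAIRWISE DISJOINT supports (no exchange terms), beyond the range of the others.
  This replaces the dossier's Boltzmann-frame pigeonhole insertion + (Bose=abs).
* `stub_dominance` (M–L): FLOOR + INS ⇒ at low density, eventually in `N`, the UNCONFINED UNION
  `U_D = {X ∈ F_b : the component of X carries no persistent D-confinement}` is open and DOMINATES: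
  `E₀ + γ ∫_{U_Dᶜ} |Ψ|² ≤ energy Ψ` for every trial state, `γ = c_F/D² − C/ℓ² > 0` (parameter choice
  `ℓ = (Cρ)^{-1/3}`, `D = c′ℓ`; component-wise restriction of finite-energy `C¹` states is `C¹` because
  `Ψ` and `∇Ψ` vanish on the contact set; finitely many groups of confined components by least confining
  datum; ENNReal bookkeeping).
* `stub_vanishOffDominant` (S–M): dominance ⇒ every closed-form ground state vanishes a.e. off `U_D`.
* `stub_uniquenessKernelZoo`: verbatim Stub 22 of line `Sketch` (shared open stub; this line does not
  attack the zoo — but note that a bonded pair inside a hollow shell IS a persistent pair confinement at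
  any scale `D ≥ R₀`, so the same pricing removes bonded sectors; what the zoo adds is measure theory and
  positivity through integrable spikes).

Composition (kernel-checked, no `sorry` of its own): essentially bounded `v` and `v` essentially locally
bounded on `(0,∞)` by the LANDED class closures (`hasUniqueGroundState_of_essBounded`,
`hasUniqueGroundState_of_essLocBdd`, `stub_finiteEnergyLowDensity`); the flagship hard-core class
`v = ⊤·1_{[0,b]} + (tail ≤ C)` (essentially) by: pointwise representative off a null set of radii →
`stub_dominance` (fed with FLOOR, INS) → carrier `U_D` open, dominant → `stub_vanishOffDominant` (ground
states live on `U_D`) → `stub_unconfinedUnique` (`U_D` pairwise joined in `F_b`) → landed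
`stub_polygonalChain` / `stub_posOfConnected (stub_chainedTube stub_localTubeCore)` /
`groundStateEnergy_trunc_iSup_hardCore` / `stub_uniqueOfPosOn stub_lincombGroundState` /
`stub_existsNonnegGroundState stub_compactness` exactly as in the landed
`hasUniqueGroundState_hardCore_of_joined`, with the carrier `S := U_D` in place of the whole free region;
the zoo by Stub 22; rigidity from uniqueness by the landed `stub_rigidityOfUnique stub_compactness`.

Disproof used (Cruxes/GroundStateRigidity/Disproof.lean + Theorems/…/Negative/*): the line USES finite
range (`stub_insertionBose` needs `ℓ ≥ R₀`; honours `groundStateRigidity_false_without_finiteRange`) and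
USES low density twice (`E₀ < ⊤` eventually via `stub_finiteEnergyLowDensity`; `γ > 0` needs
`C ρ^{2/3} < c_F/D²`, honours `groundStateRigidity_false_at_all_densities` and
`Negative/TwoHardSpheres` (`N = 2`, `1/3 < L² < 1/2`: there BOTH components are wall-confined at every
scale `D < L`, so `U_D = ∅` and dominance would force `E₀ = ⊤` — consistent: that box is not dilute)).
-/

noncomputable section

open MeasureTheory Filter Metric
open scoped ENNReal NNReal ComplexConjugate Topology

namespace Summit.AtomisticToContinuum.BoseEinsteinCondensation.Cruxes.GroundStateRigidity.PersistentConfinement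

open Literature.MathematicalPhysics.QuantumManyBody.BoseGas
open Summit.AtomisticToContinuum.BoseEinsteinCondensation.Theses.BECCutLineWeakDisorder
open Summit.AtomisticToContinuum.BoseEinsteinCondensation.Theorems.GroundStateRigidity

/-- The box side `(N/ρ)^{1/3}` is positive for `ρ > 0`, `N ≥ 1`. [folklore] -/
theorem sideLength_pos_of_one_le {ρ : ℝ} (hρ : 0 < ρ) {N : ℕ} (hN : 1 ≤ N) : 0 < sideLength ρ N := by
  unfold sideLength
  have h : (0 : ℝ) < (N : ℝ) / ρ := div_pos (by exact_mod_cast hN) hρ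
  exact Real.rpow_pos_of_pos h _

/-! ## Stubs (`sorry` only inside `stub_*`) -/

/-- **Stub K — OPEN KERNEL (pure discrete geometry): unconfined components of the dilute hard-sphere
free region coincide.** There are absolute `c₁, K₁ > 0` such that for `K₁ b ≤ D` and `N D³ ≤ c₁ L³` any two
configurations `X, Y` of the free region `F_b(N,L) = {Z ∈ Λ_L^N : |zᵢ − zⱼ| > b}` whose path components
carry NO persistent `D`-confinement are joined by a path in `F_b(N,L)`; a component `C` carries a
persistent `D`-confinement when there are labels `p, q` such that at EVERY configuration `Z` of `C` the
label `p` is within `D` of SOME wall face (`z_{p,k} ≤ D` or `z_{p,k} ≥ L − D` for some `k`, which may vary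
with `Z`) or (`q ≠ p` and) within `D` of the FIXED label `q` — the confining frame may alternate between the
walls and `q` along `C`; only the label `p` (and its one partner `q`) are fixed. Weaker than `CubeConnected`
(Stub 21 of line `Sketch`: all of `F_b` joined) and than the (TT) reshape of NOTES-c4-KERNEL §3 (a whole
backbone pinned to fixed balls of radius `K b`); true for every known trap (jammed or near-jammed
wall-braced backbones keep their wall footings and their contacts at scale `O(b) ≤ D`); fails only for two
distinct "treadmill" components (every label becomes `D`-free of the walls and of each fixed partner
somewhere in the component, yet the component never dissolves). With labels the unconfined union is
`S_N`- and cube-invariant, so no parking lemma and no reference configuration are needed (parked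
configurations are joined one sphere at a time once `K₁` is large, inside the kernel).
[cite: BaryshnikovBubenikKahle2013, §6; Kahle2012] -/
theorem stub_unconfinedUnique :
    ∃ c₁ : ℝ, 0 < c₁ ∧ ∃ K₁ : ℝ, 0 < K₁ ∧ ∀ (N : ℕ) (L b D : ℝ), 0 < b → K₁ * b ≤ D →
      (N : ℝ) * D ^ 3 ≤ c₁ * L ^ 3 →
      ∀ X ∈ {Z : Config N | Z ∈ boxN N L ∧ ∀ i j : Fin N, i ≠ j → b < dist (Z i) (Z j)},
      ∀ Y ∈ {Z : Config N | Z ∈ boxN N L ∧ ∀ i j : Fin N, i ≠ j → b < dist (Z i) (Z j)},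
        (¬ ∃ p q : Fin N, ∀ Z : Config N,
            JoinedIn {W : Config N | W ∈ boxN N L ∧ ∀ i j : Fin N, i ≠ j → b < dist (W i) (W j)} X Z →
              (∃ k : Fin 3, Z p k ≤ D ∨ L - D ≤ Z p k) ∨ (q ≠ p ∧ dist (Z p) (Z q) ≤ D)) →
        (¬ ∃ p q : Fin N, ∀ Z : Config N,
            JoinedIn {W : Config N | W ∈ boxN N L ∧ ∀ i j : Fin N, i ≠ j → b < dist (W i) (W j)} Y Z →
              (∃ k : Fin 3, Z p k ≤ D ∨ L - D ≤ Z p k) ∨ (q ≠ p ∧ dist (Z p) (Z q) ≤ D)) →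
        JoinedIn {Z : Config N | Z ∈ boxN N L ∧ ∀ i j : Fin N, i ≠ j → b < dist (Z i) (Z j)} X Y := by
  sorry

/-- **Stub FLOOR — the kinetic price of one confined label (every `v ≥ 0`, no symmetry).** There is an
absolute `c_F > 0` such that for a `C¹` function `ψ` of `N + 1` particles vanishing off the open box
`Λ_L^{N+1}` on whose support the label `p` is always within `D` of SOME wall face or (`q ≠ p` and) within
`D` of the fixed label `q`, one has `(E₀(N, L) + c_F/D²) ∫|ψ|² ≤ ∫ (|∇ψ|² + Σ_{i<j} v |ψ|²)`: fibrewise in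
`x_p` (the other labels frozen) the fibre function `u` is supported in the six wall slabs of width `D`
united with the closed `D`-ball around `x_q`; every point of a slab sees a zero of `u` (the wall) within
length `D` along that slab's normal, and every point of the ball NOT in a slab sees a zero of `u` within
length `2D + 0` along `e₁` (the point `x − (x₁ − x_{q,1} + D + ε)e₁` lies outside ball and slabs — else
`x` itself would lie in that slab); the one-sided one-dimensional Poincaré inequality
`∫₀^ℓ |u|² ≤ ℓ² ∫₀^ℓ |u′|²` (fundamental theorem + Cauchy–Schwarz, no sharp constant needed) with overlap
multiplicity `≤ 7` gives `∫|∂ψ|² ≥ (c_F/D²)∫|ψ|²` on the fibre; fibrewise in the other `N` labels the slice is `C¹`,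
Dirichlet, and after the diamagnetic `√`-symmetrisation `(N!⁻¹ Σ_π |ψ_slice ∘ π|²)^{1/2}` (smoothed by the
tree's `sqrtReg`, `|∇ √(Σ|f_π|²)|² ≤ Σ |∇ f_π|²`) and renormalisation an admissible `N`-body trial state, so
its energy with the interactions among those `N` labels only (`v ≥ 0`: drop the pairs through `p`) is
`≥ E₀(N, L)` times its mass (reindex `Fin (N+1) ∖ {p} ≃ Fin N` by `Fin.succAbove`); Tonelli. If the slice
masses vanish the claim is trivial; if `E₀(N, L) = ⊤` no finite-energy `ψ` with positive mass exists, by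
the same slicing. [cite: ReedSimonIV1978, §XIII.15 Prop 3 (Dirichlet bracketing); LSSY2005, (2.3)] -/
theorem stub_frameConfinementFloor :
    ∃ cF : ℝ, 0 < cF ∧ ∀ (N : ℕ) (L D : ℝ) (v : ℝ → ℝ≥0∞) (p q : Fin (N + 1)) (ψ : Config (N + 1) → ℂ),
      0 < L → 0 < D → Measurable v → ContDiff ℝ 1 ψ → (∀ X, X ∉ boxN (N + 1) L → ψ X = 0) →
      (∀ X, ψ X ≠ 0 → (∃ k : Fin 3, X p k ≤ D ∨ L - D ≤ X p k) ∨ (q ≠ p ∧ dist (X p) (X q) ≤ D)) →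
      (groundStateEnergy v N L + ENNReal.ofReal (cF / D ^ 2)) * ∫⁻ X, (‖ψ X‖₊ : ℝ≥0∞) ^ 2 ≤
        ∫⁻ X, kineticDensity ψ X + interaction v X * (‖ψ X‖₊ : ℝ≥0∞) ^ 2 := by
  sorry

/-- **Stub INS — the Bose-frame insertion window (every finite-range `v ≥ 0`).** There is an absolute
`C > 0` such that `E₀(N+1, L) ≤ E₀(N, L) + C/ℓ²` whenever `v` vanishes beyond `R₀ ≤ ℓ` and
`C (N+1) ℓ³ ≤ L³`. Proof plan (no Jastrow factor, no eigenfunction identity, no exchange terms): take a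
near-minimising `N`-body trial state `Φ`; tile `Λ_L` by `≥ 100 (N+1)` cubes of side `5ℓ` with concentric
core `c` (side `ℓ`), collar `c′ ⊃ c` and `c″ ⊃ c′` (margins `ℓ ≥ R₀`); at EVERY configuration at most
`27 N` cells have an occupied `c″` and every particle lies in `≤ 27` collars, so by averaging over cells some
FIXED cell `c₀` has `P_Φ(c₀″ empty) ≥ 1/2` and expected collar occupation `≤ 1`; with the symmetric `C¹`
angle `θ(X) = (π/2) φ(Σᵢ h(xᵢ))` (`h = 1` on `c₀′`, `0` off `c₀″`, `|∇h| ≤ 4/ℓ`) the IMS identity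
`q(cos θ·Φ) + q(sin θ·Φ) = q(Φ) + ∫ |∇θ|²|Φ|²` and the variational bound on the (symmetric, `C¹`,
Dirichlet) `sin θ·Φ` give `q(cos θ·Φ) ≤ (E₀(N) + O(ℓ⁻²) + slack)·‖cos θ·Φ‖²` with `‖cos θ·Φ‖² ≥ 1/2` and
`cos θ·Φ = 0` whenever a particle is in `c₀′`; insert particle `N+1` in the Dirichlet ground state of
`c₀` (energy `3π²/ℓ²`), out of range of the others; the Bose symmetrisation `(N+1)^{-1/2} Σ_k G_k` has
pairwise DISJOINTLY supported terms (`x_k ∈ c₀` in `G_k`, `x_k ∉ c₀′` in `G_l`), so norm and energy add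
exactly. `N = 0`: `E₀(1, L) = 3π²/L² ≤ C/ℓ²`. If `E₀(N, L) = ⊤` the claim is trivial.
[cite: LSSY2005, Thm 2.4 (cell method, upper bound side); ReedSimonIV1978, §XIII.15] -/
theorem stub_insertionBose :
    ∃ C : ℝ, 0 < C ∧ ∀ (N : ℕ) (L ℓ R₀ : ℝ) (v : ℝ → ℝ≥0∞), Measurable v → 0 < R₀ →
      (∀ r : ℝ, R₀ < r → v r = 0) → 0 < L → 0 < ℓ → R₀ ≤ ℓ → C * ((N : ℝ) + 1) * ℓ ^ 3 ≤ L ^ 3 →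
      groundStateEnergy v (N + 1) L ≤ groundStateEnergy v N L + ENNReal.ofReal (C / ℓ ^ 2) := by
  sorry

/-- **Stub DOM — at low density the unconfined union dominates (hard-core class; FLOOR and INS as
hypotheses).** Let `v = ⊤` on `[0, b]`, `v = 0` beyond `R₀`, measurable. Given the FLOOR and INS statements
and any targets `c₁, K₁ > 0`, there is `ρ₂ > 0` such that for `0 < ρ < ρ₂` and all large `N`, IF
`E₀(N, L) < ⊤` at `L = (N/ρ)^{1/3}` THEN for some scale `D` with `K₁ b ≤ D`, `N D³ ≤ c₁ L³` and some `γ > 0`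
the unconfined union `U_D = {X ∈ F_b(N,L) : the component of X carries no persistent D-confinement}` is
open and `E₀ + γ ∫_{U_Dᶜ} |Ψ|² ≤ energy Ψ` for every trial state `Ψ`. Plan: `ℓ = (Cρ)^{-1/3}` (so
`C N ℓ³ = L³`, and `R₀ ≤ ℓ` once `ρ ≤ 1/(C R₀³)`), `D = c′ℓ` with `c′³ ≤ c₁ C`, `c′² < c_F/C`,
`ρ ≤ c′³/(C K₁³ b³)`; `γ = c_F/D² − C/ℓ² > 0`. A finite-energy `C¹` trial state `Ψ` and its gradient
vanish on the contact set `{some pair ≤ b} ∪ ∂Λ^N` (interaction `= ⊤` there; closure of the interior), so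
`Ψ·1_W` is `C¹` Dirichlet for every union `W` of components of `F_b`, and energy is additive over the
finite partition `F_b = U_D ⊔ ⨆_{(p,f)} W_{p,f}` (components grouped by their least confining datum);
`Ψ·1_{U_D}` is Bose-symmetric (`U_D` is `S_N`-invariant) so its energy is `≥ E₀‖Ψ 1_{U_D}‖²`; each
`Ψ·1_{W_{p,f}}` is confined, so FLOOR (at `N − 1 + 1`) and INS give energy
`≥ (E₀(N−1) + c_F/D²)·mass ≥ (E₀(N) + γ)·mass`; sum. Openness: components of the open `F_b` are open and the
confinement predicate is constant on components. [cite: ReedSimonIV1978, §XIII.15 Prop 4] -/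
theorem stub_dominance :
    (∃ cF : ℝ, 0 < cF ∧ ∀ (N : ℕ) (L D : ℝ) (v : ℝ → ℝ≥0∞) (p q : Fin (N + 1)) (ψ : Config (N + 1) → ℂ),
      0 < L → 0 < D → Measurable v → ContDiff ℝ 1 ψ → (∀ X, X ∉ boxN (N + 1) L → ψ X = 0) →
      (∀ X, ψ X ≠ 0 → (∃ k : Fin 3, X p k ≤ D ∨ L - D ≤ X p k) ∨ (q ≠ p ∧ dist (X p) (X q) ≤ D)) →
      (groundStateEnergy v N L + ENNReal.ofReal (cF / D ^ 2)) * ∫⁻ X, (‖ψ X‖₊ : ℝ≥0∞) ^ 2 ≤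
        ∫⁻ X, kineticDensity ψ X + interaction v X * (‖ψ X‖₊ : ℝ≥0∞) ^ 2) →
    (∃ C : ℝ, 0 < C ∧ ∀ (N : ℕ) (L ℓ R₀ : ℝ) (v : ℝ → ℝ≥0∞), Measurable v → 0 < R₀ →
      (∀ r : ℝ, R₀ < r → v r = 0) → 0 < L → 0 < ℓ → R₀ ≤ ℓ → C * ((N : ℝ) + 1) * ℓ ^ 3 ≤ L ^ 3 →
      groundStateEnergy v (N + 1) L ≤ groundStateEnergy v N L + ENNReal.ofReal (C / ℓ ^ 2)) →
    ∀ (v : ℝ → ℝ≥0∞) (b R₀ c₁ K₁ : ℝ), Measurable v → 0 < b → 0 < R₀ →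
      (∀ s : ℝ, s ∈ Set.Icc 0 b → v s = ⊤) → (∀ r : ℝ, R₀ < r → v r = 0) → 0 < c₁ → 0 < K₁ →
      ∃ ρ₂ : ℝ, 0 < ρ₂ ∧ ∀ ρ : ℝ, 0 < ρ → ρ < ρ₂ → ∀ᶠ N : ℕ in atTop,
        groundStateEnergy v N (sideLength ρ N) ≠ ⊤ →
        ∃ D : ℝ, K₁ * b ≤ D ∧ (N : ℝ) * D ^ 3 ≤ c₁ * sideLength ρ N ^ 3 ∧
        ∃ γ : ℝ≥0∞, 0 < γ ∧
          IsOpen {X : Config N | X ∈ {Z : Config N | Z ∈ boxN N (sideLength ρ N) ∧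
              ∀ i j : Fin N, i ≠ j → b < dist (Z i) (Z j)} ∧
            ¬ ∃ p q : Fin N, ∀ Z : Config N,
              JoinedIn {W : Config N | W ∈ boxN N (sideLength ρ N) ∧
                ∀ i j : Fin N, i ≠ j → b < dist (W i) (W j)} X Z →
                (∃ k : Fin 3, Z p k ≤ D ∨ sideLength ρ N - D ≤ Z p k) ∨
                  (q ≠ p ∧ dist (Z p) (Z q) ≤ D)} ∧
          ∀ Ψ : TrialState N (sideLength ρ N),
            groundStateEnergy v N (sideLength ρ N) +
                γ * ∫⁻ X in {X : Config N | X ∈ {Z : Config N | Z ∈ boxN N (sideLength ρ N) ∧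
                    ∀ i j : Fin N, i ≠ j → b < dist (Z i) (Z j)} ∧
                  ¬ ∃ p q : Fin N, ∀ Z : Config N,
                    JoinedIn {W : Config N | W ∈ boxN N (sideLength ρ N) ∧
                      ∀ i j : Fin N, i ≠ j → b < dist (W i) (W j)} X Z →
                      (∃ k : Fin 3, Z p k ≤ D ∨ sideLength ρ N - D ≤ Z p k) ∨
                        (q ≠ p ∧ dist (Z p) (Z q) ≤ D)}ᶜ, (‖Ψ.ψ X‖₊ : ℝ≥0∞) ^ 2 ≤
              energy v Ψ := by
  sorry

/-- **Stub VAN — ground states live on a dominant carrier (every `v`, `N`, `L`).** If a measurable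
`U ⊆ Λ^N` dominates with a rate `γ > 0` — `E₀ + γ ∫_{Uᶜ} |Φ|² ≤ energy Φ` for every trial state `Φ` —
then every closed-form ground state `Ψ` vanishes a.e. off `U`: `closedEnergy Ψ = E₀ < ⊤` yields trial
states `Φₙ → Ψ` in `L²` with `energy Φₙ → E₀` along a subsequence (definition of `closedEnergy` as an
infimum of `liminf`s), so `γ ∫_{Uᶜ}|Φₙ|² → 0`, and `∫_{Uᶜ}|Ψ|² ≤ 2∫|Φₙ − Ψ|² + 2∫_{Uᶜ}|Φₙ|² → 0`.
[cite: Kato1966, VI §1.3 Thm 1.16; ReedSimonIV1978, §XIII.12] -/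
theorem stub_vanishOffDominant :
    ∀ (N : ℕ) (v : ℝ → ℝ≥0∞) (L : ℝ) (U : Set (Config N)) (γ : ℝ≥0∞), MeasurableSet U → 0 < γ →
      (∀ Φ : TrialState N L,
        groundStateEnergy v N L + γ * ∫⁻ X in Uᶜ, (‖Φ.ψ X‖₊ : ℝ≥0∞) ^ 2 ≤ energy v Φ) →
      ∀ Ψ : Config N → ℂ, IsGroundState v L Ψ → ∀ᵐ X : Config N, X ∉ U → Ψ X = 0 := by
  sorry

/-- **Stub ZOO — OPEN KERNEL (the zoo), verbatim Stub 22 of line `Sketch` (shared).** For a repulsive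
finite-range `v` with a wall at a positive radius (not essentially bounded on some `[r, ∞)`, `r > 0`) that
is NOT essentially of the form `⊤·1_{[0,b]} + (tail ≤ C on (b, ∞))`, `b > 0` — hollow shells, hard cores
with an essentially unbounded finite shoulder, fat-Cantor walls, non-integrable finite walls, integrable
spikes — closed-form ground states at density `< ρ₀(v)` are eventually unique up to phase. In this line's
language: bonded sectors are persistent PAIR confinements at every scale `D ≥ R₀` and are priced out by
FLOOR + INS exactly like traps; what remains is the hard-sphere kernel at the outermost wall radius (Stub
K) plus measure theory (essential walls, forced vanishing on non-`L¹_loc` shells) and positivity through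
integrable spikes. Not attempted by this line. [cite: ReedSimonIV1978, Thm XIII.48] -/
theorem stub_uniquenessKernelZoo :
    ∀ v : ℝ → ℝ≥0∞, IsRepulsiveFiniteRange v →
      (¬ ∀ r : ℝ, 0 < r → ∃ C : ℝ≥0, ∀ᵐ s : ℝ, r ≤ s → v s ≤ C) →
      (¬ ∃ b : ℝ, 0 < b ∧ ∃ C : ℝ≥0, (∀ᵐ s : ℝ, s ∈ Set.Icc 0 b → v s = ⊤) ∧
          (∀ᵐ s : ℝ, b < s → v s ≤ C)) →
      ∃ ρ₀ : ℝ, 0 < ρ₀ ∧ ∀ ρ : ℝ, 0 < ρ → ρ < ρ₀ → ∀ᶠ N : ℕ in atTop,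
        ∀ Ψ Φ : Config N → ℂ, IsGroundState v (sideLength ρ N) Ψ →
          IsGroundState v (sideLength ρ N) Φ →
          ∃ c : ℂ, ‖c‖ = 1 ∧ ∀ᵐ X : Config N, Φ X = c * Ψ X := by
  sorry

/-! ## Composition (sorry-free): the stubs give the crux BY NAME -/

/-- **Uniqueness on a dominant, pairwise-joined open carrier (hard-core class, fixed `(N, L)`).** The
landed carrier assembly `hasUniqueGroundState_hardCore_of_joined` with the carrier `S := U` in place of
the whole free region: existence of a nonnegative ground state (landed Stub 5b + 0), vanishing off `U`
(Stub VAN), clearance chains inside `U` (landed Stub 17 from `JoinedIn`), a.e. positivity on `U` (landed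
Stub 19 fed with landed Stubs 18, 16 and the landed hard-core energy truncation), uniqueness from
positivity (landed Stub 20 fed with Stub 6). [cite: ReedSimonIV1978, §XIII.12 Thms XIII.44–47] -/
theorem hasUniqueGroundState_of_dominant (N : ℕ) (v : ℝ → ℝ≥0∞) (L b : ℝ) (C : ℝ≥0) (hN : 1 ≤ N)
    (hL : 0 < L) (hb : 0 < b) (hv : Measurable v) (hcore : ∀ s : ℝ, s ∈ Set.Icc 0 b → v s = ⊤)
    (htail : ∀ s : ℝ, b < s → v s ≤ C) (hE : groundStateEnergy v N L ≠ ⊤)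
    (U : Set (Config N)) (hUo : IsOpen U)
    (hUF : U ⊆ {Z : Config N | Z ∈ boxN N L ∧ ∀ i j : Fin N, i ≠ j → b < dist (Z i) (Z j)})
    (hUJ : ∀ X ∈ U, ∀ Y ∈ U,
      JoinedIn {Z : Config N | Z ∈ boxN N L ∧ ∀ i j : Fin N, i ≠ j → b < dist (Z i) (Z j)} X Y)
    (γ : ℝ≥0∞) (hγ : 0 < γ)
    (hdom : ∀ Φ : TrialState N L,
      groundStateEnergy v N L + γ * ∫⁻ X in Uᶜ, (‖Φ.ψ X‖₊ : ℝ≥0∞) ^ 2 ≤ energy v Φ) :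
    HasUniqueGroundState v N L := by
  have hUm : MeasurableSet U := hUo.measurableSet
  have hvan : ∀ Ψ : Config N → ℂ, IsGroundState v L Ψ → ∀ᵐ X : Config N, X ∉ U → Ψ X = 0 :=
    stub_vanishOffDominant N v L U γ hUm hγ hdom
  refine stub_uniqueOfPosOn stub_lincombGroundState N v L U hUm
    (stub_existsNonnegGroundState stub_compactness N v L hE) hvan ?_
  intro Ψ₀ hΨ₀ hGS
  refine stub_posOfConnected (stub_chainedTube stub_localTubeCore) N v L b C hN hL hb hv hcore htail
    (groundStateEnergy_trunc_iSup_hardCore N v L b C hN hL hb hv hcore htail) U hUm hUF ?_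
    hvan Ψ₀ hΨ₀ hGS
  intro X hX Y hY
  exact stub_polygonalChain N L b X Y (hUJ X hX Y hY)

/-- **Eventual uniqueness for the essential hard-core class** `v = ⊤` a.e. on `[0,b]`, `v ≤ C` a.e. beyond
`b` (`b > 0`): null sets of radii are invisible (`hasUniqueGroundState_iff_offNull`,
`groundStateEnergy_congr_offNull`); for the pointwise representative `v'` (`⊤` on `[0,b]`, `0` beyond
`R₁ = max R₀ b`, `min (v s) C` in between), `E₀ < ⊤` eventually (landed Stub 5a), Stub DOM (fed with FLOOR
and INS, targets `c₁, K₁` from Stub K) gives an open dominant unconfined union `U_D` at an admissible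
scale `D`, Stub K joins `U_D` pairwise inside the free region, and `hasUniqueGroundState_of_dominant`
concludes. [folklore] -/
theorem uniqueHardCore (v : ℝ → ℝ≥0∞) (hv : IsRepulsiveFiniteRange v)
    (hHC : ∃ b : ℝ, 0 < b ∧ ∃ C : ℝ≥0, (∀ᵐ s : ℝ, s ∈ Set.Icc 0 b → v s = ⊤) ∧
      (∀ᵐ s : ℝ, b < s → v s ≤ C)) :
    ∃ ρ₀ : ℝ, 0 < ρ₀ ∧ ∀ ρ : ℝ, 0 < ρ → ρ < ρ₀ → ∀ᶠ N : ℕ in atTop,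
      HasUniqueGroundState v N (sideLength ρ N) := by
  obtain ⟨b, hb, C, hcoreae, htailae⟩ := hHC
  obtain ⟨R₀, hR₀, hrange⟩ := hv.exists_pos_range
  obtain ⟨c₁, hc₁, K₁, hK₁, hK⟩ := stub_unconfinedUnique
  obtain ⟨ρ₁, hρ₁, h₁⟩ := stub_finiteEnergyLowDensity v hv
  classical
  set R₁ : ℝ := max R₀ b with hR₁def
  have hR₁ : 0 < R₁ := lt_of_lt_of_le hR₀ (le_max_left R₀ b)
  have hrange₁ : ∀ r : ℝ, R₁ < r → v r = 0 := fun r hr =>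
    hrange r (lt_of_le_of_lt (le_max_left R₀ b) hr)
  -- a pointwise representative off a null set of radii: `⊤` on `[0,b]`, `0` beyond `R₁`, `≤ C` between
  set v' : ℝ → ℝ≥0∞ := fun s =>
    if s ∈ Set.Icc 0 b then ⊤ else (if R₁ < s then 0 else (if b < s then min (v s) C else v s))
    with hv'def
  set Sbad : Set ℝ := {s | s ∈ Set.Icc 0 b ∧ v s ≠ ⊤} ∪ {s | b < s ∧ (C : ℝ≥0∞) < v s} with hSbad
  have hSm : MeasurableSet Sbad := by
    refine MeasurableSet.union ?_ ?_
    · exact measurableSet_Icc.inter (hv.1 (measurableSet_singleton ⊤)).compl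
    · exact (measurableSet_lt measurable_const measurable_id).inter
        (measurableSet_lt measurable_const hv.1)
  have hS0 : volume Sbad = 0 := by
    rw [hSbad, measure_union_null_iff]
    constructor
    · rw [measure_eq_zero_iff_ae_notMem]
      filter_upwards [hcoreae] with s hs
      simp only [not_and, not_not]
      exact hs
    · rw [measure_eq_zero_iff_ae_notMem]
      filter_upwards [htailae] with s hs
      simp only [not_and, not_lt]
      exact hs
  have hvv' : ∀ r, r ∉ Sbad → v r = v' r := by
    intro r hr
    simp only [hSbad, Set.mem_union, Set.mem_setOf_eq, not_or, not_and, not_not, not_lt] at hr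
    by_cases h1 : r ∈ Set.Icc 0 b
    · simp only [hv'def]; rw [if_pos h1]; exact hr.1 h1
    · by_cases h2 : R₁ < r
      · simp only [hv'def]; rw [if_neg h1, if_pos h2]; exact hrange₁ r h2
      · by_cases h3 : b < r
        · simp only [hv'def]; rw [if_neg h1, if_neg h2, if_pos h3]
          exact (min_eq_left (hr.2 h3)).symm
        · simp only [hv'def]; rw [if_neg h1, if_neg h2, if_neg h3]
  have hv'm : Measurable v' := by
    refine Measurable.ite measurableSet_Icc measurable_const ?_
    refine Measurable.ite (measurableSet_lt measurable_const measurable_id) measurable_const ?_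
    exact Measurable.ite (measurableSet_lt measurable_const measurable_id)
      (hv.1.min measurable_const) hv.1
  have hcore' : ∀ s : ℝ, s ∈ Set.Icc 0 b → v' s = ⊤ := fun s hs => by
    simp only [hv'def]; rw [if_pos hs]
  have htail' : ∀ s : ℝ, b < s → v' s ≤ C := by
    intro s hs
    have hs' : s ∉ Set.Icc 0 b := fun h => not_lt.2 h.2 hs
    by_cases h2 : R₁ < s
    · simp only [hv'def]; rw [if_neg hs', if_pos h2]; exact zero_le
    · simp only [hv'def]; rw [if_neg hs', if_neg h2, if_pos hs]; exact min_le_right _ _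
  have hrange' : ∀ r : ℝ, R₁ < r → v' r = 0 := by
    intro r hr
    have hbr : b < r := lt_of_le_of_lt (le_max_right R₀ b) hr
    have hr' : r ∉ Set.Icc 0 b := fun h => not_lt.2 h.2 hbr
    simp only [hv'def]; rw [if_neg hr', if_pos hr]
  obtain ⟨ρ₂, hρ₂, h₂⟩ := stub_dominance stub_frameConfinementFloor stub_insertionBose v' b R₁ c₁ K₁ hv'm hb
    hR₁ hcore' hrange' hc₁ hK₁
  refine ⟨min ρ₁ ρ₂, lt_min hρ₁ hρ₂, fun ρ hρ hρm => ?_⟩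
  filter_upwards [h₁ ρ hρ (hρm.trans_le (min_le_left _ _)),
    h₂ ρ hρ (hρm.trans_le (min_le_right _ _)), eventually_ge_atTop 1] with N hE hD hN
  have hL : 0 < sideLength ρ N := sideLength_pos_of_one_le hρ hN
  have hE' : groundStateEnergy v' N (sideLength ρ N) ≠ ⊤ := by
    rwa [← groundStateEnergy_congr_offNull hSm hS0 hvv' N (sideLength ρ N)]
  obtain ⟨D, hKD, hND, γ, hγ, hUo, hdom⟩ := hD hE'
  refine (hasUniqueGroundState_iff_offNull hSm hS0 hvv').2
    (hasUniqueGroundState_of_dominant N v' (sideLength ρ N) b C hN hL hb hv'm hcore' htail' hE' _ hUo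
      (fun X hX => hX.1) ?_ γ hγ hdom)
  intro X hX Y hY
  exact hK N (sideLength ρ N) b D hb hKD hND X hX.1 Y hY.1 hX.2 hY.2

/-- **Uniqueness for admissible potentials with a wall at a positive radius, at low density** (class
(b/c)): the essential hard-core class by `uniqueHardCore` (Stubs K, FLOOR, INS, DOM, VAN), everything else
by the zoo kernel (Stub ZOO, with landed Stubs 5a, 5b, 0). [folklore] -/
theorem uniqueWall (v : ℝ → ℝ≥0∞) (hv : IsRepulsiveFiniteRange v)
    (hb : ¬ ∀ r : ℝ, 0 < r → ∃ C : ℝ≥0, ∀ᵐ s : ℝ, r ≤ s → v s ≤ C) :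
    ∃ ρ₀ : ℝ, 0 < ρ₀ ∧ ∀ ρ : ℝ, 0 < ρ → ρ < ρ₀ → ∀ᶠ N : ℕ in atTop,
      HasUniqueGroundState v N (sideLength ρ N) := by
  by_cases hHC : ∃ b : ℝ, 0 < b ∧ ∃ C : ℝ≥0, (∀ᵐ s : ℝ, s ∈ Set.Icc 0 b → v s = ⊤) ∧
      (∀ᵐ s : ℝ, b < s → v s ≤ C)
  · exact uniqueHardCore v hv hHC
  · obtain ⟨ρ₁, hρ₁, h₁⟩ := stub_finiteEnergyLowDensity v hv
    obtain ⟨ρ₂, hρ₂, h₂⟩ := stub_uniquenessKernelZoo v hv hb hHC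
    refine ⟨min ρ₁ ρ₂, lt_min hρ₁ hρ₂, fun ρ hρ hρm => ?_⟩
    filter_upwards [h₁ ρ hρ (hρm.trans_le (min_le_left _ _)),
      h₂ ρ hρ (hρm.trans_le (min_le_right _ _))] with N hE hU
    exact ⟨stub_existsNonnegGroundState stub_compactness N v (sideLength ρ N) hE, hU⟩

/-- **Eventual uniqueness for every admissible `v`**: essentially bounded `v` (landed
`hasUniqueGroundState_of_essBounded`, every density), `v` essentially locally bounded on `(0, ∞)` (landed
`hasUniqueGroundState_of_essLocBdd` with landed Stub 5a), walls at a positive radius (`uniqueWall`).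
[folklore] -/
theorem eventualUniqueness (v : ℝ → ℝ≥0∞) (hv : IsRepulsiveFiniteRange v) :
    ∃ ρ₀ : ℝ, 0 < ρ₀ ∧ ∀ ρ : ℝ, 0 < ρ → ρ < ρ₀ → ∀ᶠ N : ℕ in atTop,
      HasUniqueGroundState v N (sideLength ρ N) := by
  by_cases hbd : ∃ C : ℝ≥0, ∀ᵐ r : ℝ, v r ≤ C
  · obtain ⟨C, hCae⟩ := hbd
    refine ⟨1, one_pos, fun ρ hρ _ => ?_⟩
    filter_upwards [eventually_ge_atTop 1] with N hN
    exact hasUniqueGroundState_of_essBounded N v C (sideLength ρ N) hN hv.1 hCae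
      (sideLength_pos_of_one_le hρ hN)
  · by_cases hlb : ∀ r : ℝ, 0 < r → ∃ C : ℝ≥0, ∀ᵐ s : ℝ, r ≤ s → v s ≤ C
    · obtain ⟨ρ₁, hρ₁, h₁⟩ := stub_finiteEnergyLowDensity v hv
      refine ⟨ρ₁, hρ₁, fun ρ hρ hρ₁' => ?_⟩
      filter_upwards [h₁ ρ hρ hρ₁', eventually_ge_atTop 1] with N hE hN
      exact hasUniqueGroundState_of_essLocBdd N v (sideLength ρ N) hN
        (sideLength_pos_of_one_le hρ hN) hv.1 hlb hE
    · exact uniqueWall v hv hlb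

/-- **`GroundStateRigidity` from the registered stubs** (kernel-checked glue, no `sorry` of its own):
eventual uniqueness (above) and rigidity-from-uniqueness (landed Stub 1 fed with landed Stub 0).
[cite: ReedSimonIV1978, §XIII.12] -/
theorem GroundStateRigidity_of : GroundStateRigidity := by
  intro v hv
  obtain ⟨ρ₀, hρ₀, hU⟩ := eventualUniqueness v hv
  refine ⟨ρ₀, hρ₀, fun ρ hρ hρ₀' => ?_⟩
  filter_upwards [hU ρ hρ hρ₀'] with N hN
  intro η hη
  exact stub_rigidityOfUnique stub_compactness v N (sideLength ρ N) hN η hη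

/-- The same composition read against the verbatim-shared decl of route `BECClassicalWindow` (the item's
registered `crux_decl`; the `def`s are syntactically identical). [cite: ReedSimonIV1978, §XIII.12] -/
theorem GroundStateRigidity_proof :
    Summit.AtomisticToContinuum.BoseEinsteinCondensation.Theses.BECClassicalWindow.GroundStateRigidity :=
  GroundStateRigidity_of

/-- … and against the copy of route `BECCellInformation` (the strategist payload's bet route).
[cite: ReedSimonIV1978, §XIII.12] -/
theorem GroundStateRigidity_proof_cellInformation :
    Summit.AtomisticToContinuum.BoseEinsteinCondensation.Theses.BECCellInformation.GroundStateRigidity :=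
  GroundStateRigidity_of

end Summit.AtomisticToContinuum.BoseEinsteinCondensation.Cruxes.GroundStateRigidity.PersistentConfinement

end
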